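import Summits.BirchSwinnertonDyer.BirchSwinnertonDyer.Theorems.GenusKolyvaginAtTwoGenusPrimitiveSupplyAtTwoTwistingPrime
import Summits.BirchSwinnertonDyer.BirchSwinnertonDyer.Theorems.GenusKolyvaginAtTwoGenusPrimitiveSupplyAtTwoLoweringImageNoTwoTorsion
import HarnessLib

/-!
# Route `GenusKolyvaginAtTwo`, crux U₂ `MinimalTwinBSDTwo` (stmt-BirchSwinnertonDyer-22985), LINE 23 «twin_swap»: THE IDENTITY-PRIME DOOR, part 4c —
# the TWO-CLASS KEY LEMMA WITHOUT `ρ̄₂` ONTO (`E(ℚ)[2] = 0` suffices: image `S₃` OR `C₃`)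

Seat `bsd-line-gk2-p2` g26 (PROVER seat 2/3, cell `bsd-f1-sign2`, LINE 23 holder), `--supports stmt-BirchSwinnertonDyer-22985` (helper; closes nothing).
THEOREMS ONLY; standard axioms; UNCONDITIONAL.  **BSD is NOT proved by this file; nothing is closed.**

WHY.  Part 4a (`exists_torsionFixing_fix_h1Eval_eq_pair`, file `…IdentityDoorKeyLemma`) makes `h ↦ ([x,h],[y,h])` ONTO `E[2]²` on `Γ_{ℚ(E[2], ζ)}` when
`ρ̄_{W,2}` is onto (`End_{Γ}(E[2]) = 𝔽₂`, a transvection is available).  On the SQUARE-DISCRIMINANT part of the identity locus (image `C₃`) that is false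
(`End_{C₃}(𝔽₄) = 𝔽₄`: the image may be the graph of multiplication by `ω`), and v2.0 of the skeleton had to declare the residual OFF‴ = `Δ > 0 ∧ ¬ρ̄₂ onto ∧
¬MeetsEgg`.  But the Čebotarev step only needs the WEAK form — some `h` with `[x,h] + α`, `[y,h] + β` non-zero and distinct for prescribed translates
`α = [x,c₀]`, `β = [y,c₀]` — and THAT holds as soon as `E[2]` has no non-zero `Γ_ℚ`-fixed point (image `S₃` or `C₃`), by a count: the attained set
`Good ⊆ E[2]²` is an additive `Γ_ℚ`-stable subgroup with both projections and the sum map onto (`x, y, x+y ≠ 0`, Gross 9.1 at `2` under `E(ℚ)[2] = 0` —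
tree `GenusKolyLowering.h1_restriction_injective_two_rat'`, transitivity on `E[2] ∖ 0` — tree `GenusKolyLowering.exists_smul_eq_of_ne_zero'`); either it
contains `0 × E[2]`, `E[2] × 0` or the diagonal (then it is everything), or it is the graph of a bijection meeting each of the three forbidden affine lines
`{a = α}`, `{b = β}`, `{a + b = α + β}` at most once — `3 < 4 = #E[2]`.

* §1 `exists_torsionFixing_fix_h1Eval_ne_zero_of_noFixed` — one class, `hsurj` replaced by «no fixed point» (tree `exists_torsionFixing_mem_h1Eval_ne'` at `Stab ζ`).
* §2 **`exists_torsionFixing_fix_h1Eval_translate_of_noFixed`** — THE TWO-CLASS KEY LEMMA, weak (translate-avoiding) form, for EVERY `W/ℚ` with `E(ℚ)[2] = 0`.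
The sequel `…IdentityDoorChebotarevAllImages` reruns part 4b's Čebotarev argument on it; with it the identity door opens on the whole `Δ > 0 ∧ ¬MeetsEgg`
locus of U₂ and OFF‴ disappears from the skeleton (v2.1).

References: [MazurRubin2010] Lemma 3.5–3.6, Prop. 3.3; [GrossLMS1991] §9 Prop. 9.1; [LawsonWuthrich2016] Lemma 6.
-/

set_option linter.dupNamespace false -- tree convention: `Summit.BirchSwinnertonDyer.BirchSwinnertonDyer.Theorems` (summit = sub-problem)
set_option autoImplicit false

noncomputable section

open scoped Classical Pointwise

namespace Summit.BirchSwinnertonDyer.BirchSwinnertonDyer.Theorems.GenusExact.TwinSwap.IdentityDoor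

open WeierstrassCurve NumberField IsDedekindDomain Field
open Literature.NumberTheory.GaloisRepresentations Literature.NumberTheory.EllipticCurves
open Literature.NumberTheory
open Summit.BirchSwinnertonDyer.BirchSwinnertonDyer.Theorems.GenusKolyTwistingPrime
open Summit.BirchSwinnertonDyer.BirchSwinnertonDyer.Theorems.GenusKolyLowering
  (exists_torsionFixing_mem_h1Eval_ne' exists_smul_eq_of_ne_zero' exists_smul_fixedPointFree_rat)

/-! ## §1 One class under `E(ℚ)[2] = 0` -/

section KeyLemma

variable (W : WeierstrassCurve ℚ) [W.IsElliptic]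

/-- **One class, no fixed point**: if `E[2]` has no non-zero `Γ_ℚ`-fixed point (image `S₃` or `C₃`), `x ≠ 0` in `H¹(ℚ, E[2])` and `ζ` is a root of unity, some
`h ∈ Γ_{ℚ(E[2])}` fixing `ζ` has `[x, h] ≠ 0` (commutators fix `ζ`; tree `exists_torsionFixing_mem_h1Eval_ne'` = Gross 9.1 at `2` under `E(ℚ)[2] = 0`).
[cite: GrossLMS1991, §9 Prop. 9.1] [cite: MazurRubin2010, Lemma 3.5–3.6] -/
theorem exists_torsionFixing_fix_h1Eval_ne_zero_of_noFixed
    (hnt : ∀ P : geomTorsion W (2 : ℤ), (∀ σ : absoluteGaloisGroup ℚ, σ • P = P) → P = 0)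
    {x : galH1Torsion W (2 : ℤ)} (hx : x ≠ 0) {m : ℕ} [NeZero m] {ζ : AlgebraicClosure ℚ} (hζ : IsPrimitiveRoot ζ m) :
    ∃ h ∈ torsionFixing W (2 : ℤ), h • ζ = ζ ∧ h1Eval W (2 : ℤ) x h ≠ 0 := by
  obtain ⟨h, hh, hA, hv⟩ := exists_torsionFixing_mem_h1Eval_ne' W hnt hx (MulAction.stabilizer (absoluteGaloisGroup ℚ) ζ)
    (fun γ δ ↦ commutator_smul_rootOfUnity hζ γ δ)
  exact ⟨h, hh, hA, hv⟩

/-! ## §2 Two classes under `E(ℚ)[2] = 0`: the translate-avoiding form -/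

/-- **THE TWO-CLASS KEY LEMMA WITHOUT `ρ̄₂` ONTO.**  `W/ℚ` elliptic with NO non-zero `Γ_ℚ`-fixed point in `E[2]` (image of `ρ̄_{W,2}` = `S₃` or `C₃`);
`x, y ∈ H¹(ℚ, E[2])` with `x, y ≠ 0`, `x ≠ y`; `ζ` a root of unity; `α, β ∈ E[2]` arbitrary.  Then some `h ∈ Γ_{ℚ(E[2])}` fixing `ζ` has
**`[x,h] + α ≠ 0`, `[y,h] + β ≠ 0`, `[x,h] + α ≠ [y,h] + β`.**  (The attained pairs form an additive `Γ_ℚ`-stable subgroup `Good ≤ E[2]²` with `pr₁`, `pr₂`,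
`pr₁ + pr₂` onto; if `Good` meets `0 × E[2]`, `E[2] × 0` or the diagonal non-trivially it is all of `E[2]²`; otherwise it is a graph over `pr₁` meeting each
forbidden line `{a = α}`, `{b = β}`, `{a + b = α + β}` at most once, and `3 < 4 = #E[2]`.)  For `ρ̄₂` onto this is implied by part 4a's ONTO form; the point is
the image-`C₃` case. [cite: MazurRubin2010, Lemma 3.5–3.6 and Prop. 3.3] [cite: GrossLMS1991, §9 Prop. 9.1] -/
theorem exists_torsionFixing_fix_h1Eval_translate_of_noFixed
    (hnt : ∀ P : geomTorsion W (2 : ℤ), (∀ σ : absoluteGaloisGroup ℚ, σ • P = P) → P = 0)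
    {x y : galH1Torsion W (2 : ℤ)} (hx : x ≠ 0) (hy : y ≠ 0) (hxy : x ≠ y)
    {m : ℕ} [NeZero m] {ζ : AlgebraicClosure ℚ} (hζ : IsPrimitiveRoot ζ m) (α β : geomTorsion W (2 : ℤ)) :
    ∃ h ∈ torsionFixing W (2 : ℤ), h • ζ = ζ ∧ h1Eval W (2 : ℤ) x h + α ≠ 0 ∧ h1Eval W (2 : ℤ) y h + β ≠ 0 ∧
      h1Eval W (2 : ℤ) x h + α ≠ h1Eval W (2 : ℤ) y h + β := by
  -- ### the attained pairs
  set Good : geomTorsion W (2 : ℤ) → geomTorsion W (2 : ℤ) → Prop := fun a b ↦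
    ∃ h ∈ torsionFixing W (2 : ℤ), h • ζ = ζ ∧ h1Eval W (2 : ℤ) x h = a ∧ h1Eval W (2 : ℤ) y h = b with hGood
  -- it suffices to attain a pair off the three forbidden lines
  suffices H : ∃ a b, Good a b ∧ a + α ≠ 0 ∧ b + β ≠ 0 ∧ a + α ≠ b + β by
    obtain ⟨a, b, ⟨h, hh, hζh, rfl, rfl⟩, h1, h2, h3⟩ := H
    exact ⟨h, hh, hζh, h1, h2, h3⟩
  -- elementary facts on `V = E[2]`
  have hV2 : ∀ v : geomTorsion W (2 : ℤ), v + v = 0 := fun v ↦ by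
    rw [← two_nsmul]; exact AddSubgroup.torsionBy.nsmul v
  have hneg : ∀ v : geomTorsion W (2 : ℤ), -v = v := fun v ↦ by
    rw [neg_eq_iff_add_eq_zero, hV2]
  have hsub : ∀ v w : geomTorsion W (2 : ℤ), v - w = v + w := fun v w ↦ by rw [sub_eq_add_neg, hneg]
  have haddself : ∀ v w : geomTorsion W (2 : ℤ), v + (v + w) = w := fun v w ↦ by rw [← add_assoc, hV2, zero_add]
  -- conjugates of `ζ`-fixing elements fix `ζ`
  have hpow : ∀ σ : absoluteGaloisGroup ℚ, ∃ i : ℕ, σ • ζ = ζ ^ i := fun σ ↦ by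
    have h1 : (σ • ζ) ^ m = 1 := by rw [← smul_pow', hζ.pow_eq_one, smul_one]
    obtain ⟨i, -, hi⟩ := hζ.eq_pow_of_pow_eq_one h1
    exact ⟨i, hi.symm⟩
  have hconj : ∀ σ h : absoluteGaloisGroup ℚ, h • ζ = ζ → (σ * h * σ⁻¹) • ζ = ζ := by
    intro σ h hh
    obtain ⟨i, hi⟩ := hpow σ⁻¹
    rw [mul_smul, mul_smul, hi, smul_pow', hh, ← hi, smul_inv_smul]
  -- (G0) (Gadd) (Gsub) (Gsmul)
  have G0 : Good 0 0 := ⟨1, one_mem _, one_smul _ _, h1Eval_one W _ x, h1Eval_one W _ y⟩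
  have Gadd : ∀ {a b a' b'}, Good a b → Good a' b' → Good (a + a') (b + b') := by
    rintro a b a' b' ⟨h, hh, hζh, rfl, rfl⟩ ⟨h', hh', hζh', rfl, rfl⟩
    exact ⟨h * h', mul_mem hh hh', by rw [mul_smul, hζh', hζh], h1Eval_mul W _ x hh h', h1Eval_mul W _ y hh h'⟩
  have Gsub : ∀ {a b a' b'}, Good a b → Good a' b' → Good (a - a') (b - b') := by
    intro a b a' b' h h'
    rw [hsub, hsub]
    exact Gadd h h'
  have Gsmul : ∀ (σ : absoluteGaloisGroup ℚ) {a b}, Good a b → Good (σ • a) (σ • b) := by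
    rintro σ a b ⟨h, hh, hζh, rfl, rfl⟩
    exact ⟨σ * h * σ⁻¹, (torsionFixing_normal W _).conj_mem h hh σ, hconj σ h hζh, h1Eval_conj W _ x σ hh, h1Eval_conj W _ y σ hh⟩
  -- the three one-class witnesses
  have hT : ∀ P : geomTorsion W (2 : ℤ), 2 • P = 0 := fun P ↦ AddSubgroup.torsionBy.nsmul P
  have hxy' : x + y ≠ 0 := fun h0 ↦ hxy (by
    have := eq_neg_of_add_eq_zero_left h0
    rw [this]
    have h2 : y + y = 0 := by
      rw [← two_nsmul]
      exact galoisCohomology.nsmul_eq_zero_of_forall (W.torsionGaloisModule (2 : ℤ)) hT y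
    exact (neg_eq_iff_add_eq_zero.mpr h2))
  obtain ⟨h₁, hh₁, hζ₁, hv₁⟩ := exists_torsionFixing_fix_h1Eval_ne_zero_of_noFixed W hnt hx hζ
  obtain ⟨h₂, hh₂, hζ₂, hv₂⟩ := exists_torsionFixing_fix_h1Eval_ne_zero_of_noFixed W hnt hy hζ
  obtain ⟨h₃, hh₃, hζ₃, hv₃⟩ := exists_torsionFixing_fix_h1Eval_ne_zero_of_noFixed W hnt hxy' hζ
  have W1 : Good (h1Eval W _ x h₁) (h1Eval W _ y h₁) := ⟨h₁, hh₁, hζ₁, rfl, rfl⟩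
  have W2 : Good (h1Eval W _ x h₂) (h1Eval W _ y h₂) := ⟨h₂, hh₂, hζ₂, rfl, rfl⟩
  have W3 : Good (h1Eval W _ x h₃) (h1Eval W _ y h₃) := ⟨h₃, hh₃, hζ₃, rfl, rfl⟩
  have hv₃' : h1Eval W _ x h₃ ≠ h1Eval W _ y h₃ := by
    intro heq
    apply hv₃
    rw [h1Eval_add W _ x y hh₃, heq, hV2]
  -- transitivity on `E[2] ∖ 0` (no fixed point ⟹ a `3`-cycle is available)
  have T1 : ∀ {p q : geomTorsion W (2 : ℤ)}, p ≠ 0 → q ≠ 0 → ∃ σ : absoluteGaloisGroup ℚ, σ • p = q :=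
    fun hp hq ↦ exists_smul_eq_of_ne_zero' W hnt hp hq
  -- two distinct non-zero vectors `p, q` (and `p + q`: the third)
  haveI : Finite (geomTorsion W (2 : ℤ)) := Nat.finite_of_card_ne_zero (by rw [natCard_geomTorsion_two_rat W]; norm_num)
  haveI : Nontrivial (geomTorsion W (2 : ℤ)) := by
    rw [← Finite.one_lt_card_iff_nontrivial, natCard_geomTorsion_two_rat W]; norm_num
  obtain ⟨p, hp⟩ := exists_ne (0 : geomTorsion W (2 : ℤ))
  obtain ⟨z, hz⟩ := exists_smul_fixedPointFree_rat W hnt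
  have hq : z • p ≠ 0 := fun h ↦ hp ((smul_eq_zero_iff_eq z).mp h)
  have hqp : z • p ≠ p := fun h ↦ hp (hz _ h)
  set q := z • p with hqdef
  -- every first coordinate, every second coordinate, and some off-diagonal pair are attained
  have ex1 : ∀ a, ∃ b, Good a b := by
    intro a
    by_cases ha : a = 0
    · exact ⟨0, by rw [ha]; exact G0⟩
    · obtain ⟨σ, hσ⟩ := T1 hv₁ ha
      exact ⟨σ • h1Eval W _ y h₁, by rw [← hσ]; exact Gsmul σ W1⟩
  have ex2 : ∀ b, ∃ a, Good a b := by
    intro b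
    by_cases hb : b = 0
    · exact ⟨0, by rw [hb]; exact G0⟩
    · obtain ⟨σ, hσ⟩ := T1 hv₂ hb
      exact ⟨σ • h1Eval W _ x h₂, by rw [← hσ]; exact Gsmul σ W2⟩
  -- (A) a non-trivial intersection with `E[2] × 0` or `0 × E[2]` makes `Good` everything
  have allOfRow : (∃ a₀, a₀ ≠ 0 ∧ Good a₀ 0) → ∀ a b, Good a b := by
    rintro ⟨a₀, ha₀, hG⟩ a b
    obtain ⟨a', ha'⟩ := ex2 b
    by_cases hd : a - a' = 0
    · rw [sub_eq_zero] at hd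
      rw [hd]; exact ha'
    · obtain ⟨σ, hσ⟩ := T1 ha₀ hd
      have h1 : Good (a - a') 0 := by
        have := Gsmul σ hG
        rwa [smul_zero, hσ] at this
      have := Gadd h1 ha'
      rwa [sub_add_cancel, zero_add] at this
  have allOfCol : (∃ b₀, b₀ ≠ 0 ∧ Good 0 b₀) → ∀ a b, Good a b := by
    rintro ⟨b₀, hb₀, hG⟩ a b
    obtain ⟨b', hb'⟩ := ex1 a
    by_cases hd : b - b' = 0
    · rw [sub_eq_zero] at hd
      rw [hd]; exact hb'
    · obtain ⟨σ, hσ⟩ := T1 hb₀ hd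
      have h1 : Good 0 (b - b') := by
        have := Gsmul σ hG
        rwa [smul_zero, hσ] at this
      have := Gadd hb' h1
      rwa [add_zero, add_sub_cancel] at this
  -- a non-trivial intersection with the diagonal also does (via the off-diagonal witness `W3`)
  have allOfDiag : (∃ d₀, d₀ ≠ 0 ∧ Good d₀ d₀) → ∀ a b, Good a b := by
    rintro ⟨d₀, hd₀, hG⟩
    apply allOfRow
    -- `(a₃, b₃) - (b₃, b₃) = (a₃ - b₃, 0)` with `a₃ ≠ b₃`
    have hd : h1Eval W _ x h₃ - h1Eval W _ y h₃ ≠ 0 := sub_ne_zero.mpr hv₃'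
    refine ⟨_, hd, ?_⟩
    by_cases hb₃ : h1Eval W _ y h₃ = 0
    · have := W3
      rw [hb₃] at this ⊢
      rwa [sub_zero]
    · obtain ⟨σ, hσ⟩ := T1 hd₀ hb₃
      have hdiag : Good (h1Eval W _ y h₃) (h1Eval W _ y h₃) := by
        have := Gsmul σ hG
        rwa [hσ] at this
      have := Gsub W3 hdiag
      rwa [sub_self] at this
  -- when `Good` is everything: take `(p - α, q - β)`
  have done_of_all : (∀ a b, Good a b) → ∃ a b, Good a b ∧ a + α ≠ 0 ∧ b + β ≠ 0 ∧ a + α ≠ b + β := fun hall ↦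
    ⟨p - α, q - β, hall _ _, by rwa [sub_add_cancel], by rwa [sub_add_cancel], by
      rw [sub_add_cancel, sub_add_cancel]; exact hqp.symm⟩
  by_cases hrow : ∃ a₀, a₀ ≠ 0 ∧ Good a₀ 0
  · exact done_of_all (allOfRow hrow)
  by_cases hcol : ∃ b₀, b₀ ≠ 0 ∧ Good 0 b₀
  · exact done_of_all (allOfCol hcol)
  by_cases hdiag : ∃ d₀, d₀ ≠ 0 ∧ Good d₀ d₀
  · exact done_of_all (allOfDiag hdiag)
  -- (B) otherwise `Good` is a graph over `pr₁` meeting each forbidden line at most once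
  push Not at hrow hcol hdiag
  have U1 : ∀ {a b b'}, Good a b → Good a b' → b = b' := by
    intro a b b' h h'
    have hd := Gsub h h'
    rw [sub_self] at hd
    by_contra hne
    exact hcol _ (sub_ne_zero.mpr hne) hd
  have U2 : ∀ {a a' b}, Good a b → Good a' b → a = a' := by
    intro a a' b h h'
    have hd := Gsub h h'
    rw [sub_self] at hd
    by_contra hne
    exact hrow _ (sub_ne_zero.mpr hne) hd
  have U3 : ∀ {a b a' b'}, Good a b → Good a' b' → a + α = b + β → a' + α = b' + β → a = a' := by
    intro a b a' b' h h' hs hs'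
    have h1 : a - b = β - α := by rw [sub_eq_sub_iff_add_eq_add, hs, add_comm]
    have h2 : a' - b' = β - α := by rw [sub_eq_sub_iff_add_eq_add, hs', add_comm]
    have hab : a - a' = b - b' := by
      have h3 : a - b = a' - b' := h1.trans h2.symm
      rw [sub_eq_sub_iff_add_eq_add] at h3 ⊢
      rw [h3, add_comm]
    have hd := Gsub h h'
    rw [← hab] at hd
    by_contra hne
    exact hdiag _ (sub_ne_zero.mpr hne) hd
  -- a section `f` of `pr₁`
  choose f hf using ex1
  -- the three forbidden classes, each with at most one member
  haveI : Fintype (geomTorsion W (2 : ℤ)) := Fintype.ofFinite _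
  have hcard : (Finset.univ : Finset (geomTorsion W (2 : ℤ))).card = 4 := by
    rw [Finset.card_univ, ← Nat.card_eq_fintype_card, natCard_geomTorsion_two_rat W]
  set S₁ : Finset (geomTorsion W (2 : ℤ)) := Finset.univ.filter (fun a ↦ a + α = 0) with hS₁
  set S₂ : Finset (geomTorsion W (2 : ℤ)) := Finset.univ.filter (fun a ↦ f a + β = 0) with hS₂
  set S₃ : Finset (geomTorsion W (2 : ℤ)) := Finset.univ.filter (fun a ↦ a + α = f a + β) with hS₃
  have hS₁c : S₁.card ≤ 1 := Finset.card_le_one.mpr fun a ha a' ha' ↦ by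
    rw [hS₁, Finset.mem_filter] at ha ha'
    rw [add_eq_zero_iff_eq_neg] at ha ha'
    rw [ha.2, ha'.2]
  have hS₂c : S₂.card ≤ 1 := Finset.card_le_one.mpr fun a ha a' ha' ↦ by
    rw [hS₂, Finset.mem_filter] at ha ha'
    rw [add_eq_zero_iff_eq_neg] at ha ha'
    have hfa : f a = f a' := by rw [ha.2, ha'.2]
    exact U2 (hf a) (hfa ▸ hf a')
  have hS₃c : S₃.card ≤ 1 := Finset.card_le_one.mpr fun a ha a' ha' ↦ by
    rw [hS₃, Finset.mem_filter] at ha ha'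
    exact U3 (hf a) (hf a') ha.2 ha'.2
  -- count: `4 ≤ 3` is absurd, so some `a` lies off all three lines
  by_contra hnone
  push Not at hnone
  have hcover : (Finset.univ : Finset (geomTorsion W (2 : ℤ))) ⊆ S₁ ∪ S₂ ∪ S₃ := by
    intro a _
    rw [Finset.mem_union, Finset.mem_union, hS₁, hS₂, hS₃, Finset.mem_filter, Finset.mem_filter, Finset.mem_filter]
    by_cases h1 : a + α = 0
    · exact Or.inl (Or.inl ⟨Finset.mem_univ _, h1⟩)
    by_cases h2 : f a + β = 0
    · exact Or.inl (Or.inr ⟨Finset.mem_univ _, h2⟩)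
    exact Or.inr ⟨Finset.mem_univ _, hnone a (f a) (hf a) h1 h2⟩
  have := (Finset.card_le_card hcover).trans ((Finset.card_union_le _ _).trans
    (Nat.add_le_add_right (Finset.card_union_le _ _) _))
  omega

end KeyLemma

end Summit.BirchSwinnertonDyer.BirchSwinnertonDyer.Theorems.GenusExact.TwinSwap.IdentityDoor

end
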